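import Summits.RiemannHypothesis.RiemannHypothesis.Theorems.JensenLogBandXiDerivBandRealAllRates
import Summits.RiemannHypothesis.RiemannHypothesis.Theorems.JensenLogBandOneCrux
import HarnessLib

/-!
# The RUNG LEAF of J-P(P3): the log band above rate 1/8 (route JensenLogBand, RH-FREE)

RH ladder column JENSEN, rung J-P(P3) «complement region / log band on the zero side», route
«JensenLogBand» (D-0059/D-0061 rung route; custodian rh-jensen-theory g14's capstone ask 08:03:12Z,
director-rh g8's close-out order 08:18:07Z item (1)). The rung leaf
`JensenPolynomials.JensenLogBandEighth` — for every `C > 1/8` there is `n₁` with `J^{d,n}_γ` hyperbolic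
whenever `n ≥ n₁` and `C·log(d+1) ≤ n` — BY NAME, from the BAND crux `XiDerivBandRealAllRates`
(stmt-RiemannHypothesis-19913, `…Theorems.XiDerivBandRealAllRates_proof`, BAND lead rh-jensen-prover g8,
p513171) through the route's deciding theorem `Theses.JensenLogBand.closes` with the two supports
`LogBand.wideBandOfBeyond_holds`, `LogBand.logBandArith_holds` (packaged as
`LogBand.OneCrux.jensenLogBandEighth_of_xiDerivBandRealAllRates`). RH-FREE; `n₁(C)` existential
(three `Filter.Eventually` extractions in the cone, custodian audit 08:19Z). WHAT THIS IS NOT: a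
hyperbolicity range with `N(d) → ∞` (here `N(d) = O(log d)`), inside Farmer's class — nothing here
bears on zeros of `ζ` off the line or the truth of RH; `C ≤ 1/8` is not claimed.
(prover-rh-jensen-eng-2-g7-0, 2026-08-27.)
-/

noncomputable section

-- single-problem summit: `Summit.RiemannHypothesis.RiemannHypothesis.…` is the tree convention
set_option linter.dupNamespace false

namespace Summit.RiemannHypothesis.RiemannHypothesis.Theorems

/-- **RUNG LEAF J-P(P3) (RH-FREE): the log band above rate `1/8`** — for every `C > 1/8` there is
`n₁` such that the Jensen polynomial `J^{d,n}_γ` of `ξ`'s Taylor data is hyperbolic whenever `n ≥ n₁`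
and `C·log(d+1) ≤ n`. [folklore] -/
theorem jensenLogBandEighth_proof :
    Summit.RiemannHypothesis.RiemannHypothesis.Theorems.JensenPolynomials.JensenLogBandEighth :=
  JensenPolynomials.LogBand.OneCrux.jensenLogBandEighth_of_xiDerivBandRealAllRates
    XiDerivBandRealAllRates_proof

end Summit.RiemannHypothesis.RiemannHypothesis.Theorems

end
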